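import Mathlib
import Summits.ResolutionOfSingularities.ResolutionOfSingularities.Theorems.WeightedInvariantLocalWeightedDropTOT2ConflictBudgetDefs
import Summits.ResolutionOfSingularities.ResolutionOfSingularities.Theorems.WeightedInvariantLocalWeightedDropNCBranchPrimesReading
import Summits.ResolutionOfSingularities.ResolutionOfSingularities.Theorems.WeightedInvariantLocalWeightedDropPolyDescentTailTools
import Summits.ResolutionOfSingularities.ResolutionOfSingularities.Theorems.WeightedInvariantLocalWeightedDropWildMonicShiftCoeff
import Summits.ResolutionOfSingularities.ResolutionOfSingularities.Theorems.WeightedInvariantLocalWeightedDropMonicDescentShearRecentre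
import Summits.ResolutionOfSingularities.ResolutionOfSingularities.Theorems.WeightedInvariantLocalWeightedDropMonicDescentTailPointStep
import Summits.ResolutionOfSingularities.ResolutionOfSingularities.Theorems.WeightedInvariantLocalWeightedDropPureDescentShearBeta

/-!
# TOT2-LINE (P3) brick B5-D (part 1): the easy DICTIONARY — `Perm2` under the `u₁`-charts, the line prime of a `Perm2` label, linear branches

Sub-problem `ResolutionOfSingularities`, ENGINE crux `stmt-ResolutionOfSingularities-8899` (`LocalWeightedDrop`), skeleton v35 (2e806da509994632),
registered stub `stub_conflictBudget` (P3); typed split `L/res-L1-w43-stub-2/g6/P3_split_v1.lean` (7fbb6274b2c57d05), bricks B5-D6a, D6b, D6c, D7 VERBATIM.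
[OURS · L1 W4.3 · chain w43 · res-L1-w43-stub-2 g6 (owner of (P3)); def-free; over the tree's label calculus (`MonicDescent.coeff_blowOne/coeff_divOne`),
stub-1's reading `NCBranchPrimes.exists_prime_of_graphDatum` and 088's shear / `u₂`-free kit (`TOT2Curve.*`); nothing here is a statement of any
manuscript; AI-produced, gate-checked, weaker than expert review.]

* `isPermissibleTwoT_blowOneT_iff` (D6a) — for positions, `V(y,u₂)` is permissible for `blowOneT d A` iff it is for `A` (the `u₁`-chart keeps `e₁`);
* `isPermissibleTwoT_divOneT_iff` (D6b) — the same through `divOneT` under `Perm1`;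
* `exists_linePrime_of_isPermissibleTwoT` (D6c) — a `Perm2` label has the LINE top-locus prime (`X 1 ∈ P`, `X 0 ∉ P`; the graph datum `h = 0`);
* `dvd_of_toThree_mem` (D7) — LINEAR BRANCHES: if `u₂ − u₁h ∈ P` (`h` `u₂`-free, `u₁ ∉ P`) then every plane series in `P` is a multiple of `u₂ − u₁h`
  (shear by `h`, split off the `u₂`-free part, shear back; a non-zero `u₂`-free series is `u₁^n ·` unit).
-/

set_option linter.dupNamespace false -- mandated namespace of this single-conjunct summit

noncomputable section

namespace Summit.ResolutionOfSingularities.ResolutionOfSingularities.Theorems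

namespace TOT2Branch

open MvPowerSeries IsLocalRing PolyDescent MonicDescent Literature.RingTheory.TwoVariableSeries

variable {k : Type} [Field k]

/-! ## D6a / D6b: `Perm2` through the `u₁`-charts -/

/-- **B5-D6a** — `Perm2` is invariant under the `u₁`-chart (positions). -/
theorem isPermissibleTwoT_blowOneT_iff {d : ℕ} {A : Fin d → MvPowerSeries (Fin 2) k} (hA : IsPosT d A) :
    IsPermissibleTwoT d (blowOneT d A) ↔ IsPermissibleTwoT d A := by
  constructor
  · intro h j e he
    -- read the coefficient `e` of `A_j` at the exponent `(e₀ + e₁ − c, e₁)` of the chart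
    have hc : d - (j : ℕ) ≤ e 0 + e 1 := by
      have h1 : (A j).order ≤ (e.degree : ℕ∞) := MvPowerSeries.order_le (by simpa using he)
      have h2 := lt_of_lt_of_le (hA j) h1
      have hdeg : e.degree = e 0 + e 1 := by rw [Finsupp.degree_eq_sum]; simp [Fin.sum_univ_two]
      rw [hdeg] at h2
      exact (by exact_mod_cast h2 : d - (j : ℕ) < e 0 + e 1).le
    let e' : Fin 2 →₀ ℕ := Finsupp.single 0 (e 0 + e 1 - (d - (j : ℕ))) + Finsupp.single 1 (e 1)
    have he'0 : e' 0 = e 0 + e 1 - (d - (j : ℕ)) := by simp [e']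
    have he'1 : e' 1 = e 1 := by simp [e']
    have hcoeff : coeff e' (blowOneT d A j) = coeff e (A j) := by
      rw [blowOneT, coeff_blowOne, he'0, he'1, if_pos (by omega)]
      have hidx : (Finsupp.single 0 (e 0 + e 1 - (d - (j : ℕ)) + (d - (j : ℕ)) - e 1) + Finsupp.single 1 (e 1) : Fin 2 →₀ ℕ) = e :=
        finsupp_fin2_ext (by simp only [Finsupp.add_apply, Finsupp.single_apply]; simp; omega)
          (by simp only [Finsupp.add_apply, Finsupp.single_apply]; simp)
      rw [hidx]
    have := h j e' (by rw [hcoeff]; exact he)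
    rwa [he'1] at this
  · intro h j e he
    rw [blowOneT, coeff_blowOne] at he
    split_ifs at he with hle
    · have := h j _ he
      simpa using this
    · exact absurd rfl he

/-- **B5-D6b** — `Perm2` is invariant under the `V(y,u₁)`-chart (under `Perm1`). -/
theorem isPermissibleTwoT_divOneT_iff {d : ℕ} {A : Fin d → MvPowerSeries (Fin 2) k} (hA : IsPermissibleOneT d A) :
    IsPermissibleTwoT d (divOneT d A) ↔ IsPermissibleTwoT d A := by
  constructor
  · intro h j e he
    have h0 : d - (j : ℕ) ≤ e 0 := hA j e he
    have hcoeff : coeff (e - Finsupp.single 0 (d - (j : ℕ))) (divOneT d A j) = coeff e (A j) := by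
      rw [divOneT, coeff_divOne]
      have hidx : (e - Finsupp.single 0 (d - (j : ℕ)) + Finsupp.single 0 (d - (j : ℕ)) : Fin 2 →₀ ℕ) = e :=
        finsupp_fin2_ext (by simp only [Finsupp.add_apply, Finsupp.tsub_apply, Finsupp.single_apply]; simp; omega)
          (by simp only [Finsupp.add_apply, Finsupp.tsub_apply, Finsupp.single_apply]; simp)
      rw [hidx]
    have := h j (e - Finsupp.single 0 (d - (j : ℕ))) (by rw [hcoeff]; exact he)
    simpa using this
  · intro h j e he
    rw [divOneT, coeff_divOne] at he
    have := h j _ he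
    simpa using this

/-! ## D6c: the line prime of a `Perm2` label -/

/-- **B5-D6c** — a `Perm2` label has the line prime: some top-locus prime contains `u₂` and not `u₁` (the prime of the graph datum `h = 0`,
`ψ = 0`, i.e. of the line `V(y,u₂)`; stub-1's reading). -/
theorem exists_linePrime_of_isPermissibleTwoT {d : ℕ} (hd : 0 < d) {A : Fin d → MvPowerSeries (Fin 2) k} (hA : IsPosT d A)
    (h2 : IsPermissibleTwoT d A) : ∃ P ∈ topPrimes d A, (X 1 : MvPowerSeries (Fin 3) k) ∈ P ∧ (X 0 : MvPowerSeries (Fin 3) k) ∉ P := by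
  have _ := hd; have _ := hA
  have hperm : IsPermissibleTwoT d (WildMonic.shift d (shearT 0 A) 0) := by
    rwa [shearT_zero, WildMonic.shift_zero]
  have hh : ∀ e : Fin 2 →₀ ℕ, e 1 ≠ 0 → coeff e (0 : MvPowerSeries (Fin 2) k) = 0 := fun _ _ => by simp
  obtain ⟨P, hP, hPm, hF, hX1, hX0, -⟩ := NCBranchPrimes.exists_prime_of_graphDatum A hh (by simp) hperm
  refine ⟨P, ⟨hP, hPm, 1, fun h1 => hP.ne_top ((Ideal.eq_top_iff_one P).mpr h1), by rwa [one_mul]⟩, ?_, hX0⟩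
  simpa using hX1

/-! ## D7: linear branches -/

/-- A non-zero `u₂`-free plane series that maps into a prime `P` with `u₁ ∉ P` is impossible: `u₂`-free series in `P` vanish. -/
theorem eq_zero_of_noY_of_toThree_mem {P : Ideal (MvPowerSeries (Fin 3) k)} [hP : P.IsPrime] (hX : (X 0 : MvPowerSeries (Fin 3) k) ∉ P)
    {r : MvPowerSeries (Fin 2) k} (hr : ∀ e : Fin 2 →₀ ℕ, e 1 ≠ 0 → coeff e r = 0) (hmem : toThree r ∈ P) : r = 0 := by
  by_contra hr0
  obtain ⟨n, u, hu, rfl⟩ := TOT2Curve.exists_eq_X_pow_mul_unit_of_noY hr hr0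
  rw [toThree, map_mul, map_pow, rename_X] at hmem
  have hX0 : ((Fin.succAboveEmb (Fin.last 2)) (0 : Fin 2) : Fin 3) = 0 := by decide
  rw [hX0] at hmem
  rcases hP.mem_or_mem hmem with h | h
  · exact hX (hP.mem_of_pow_mem n h)
  · exact hP.ne_top (Ideal.eq_top_of_isUnit_mem P h (hu.map (rename (Fin.succAboveEmb (Fin.last 2)))))

/-- **B5-D7 — LINEAR BRANCHES**: if `u₂ − u₁·h(u₁)` lies in a prime `P` not containing `u₁`, every plane series in `P` is a multiple of `u₂ − u₁h`. -/
theorem dvd_of_toThree_mem {P : Ideal (MvPowerSeries (Fin 3) k)} [P.IsPrime] (hX : (X 0 : MvPowerSeries (Fin 3) k) ∉ P)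
    {h : MvPowerSeries (Fin 2) k} (hh : ∀ e : Fin 2 →₀ ℕ, e 1 ≠ 0 → coeff e h = 0)
    (hmem : (X 1 - X 0 * toThree h : MvPowerSeries (Fin 3) k) ∈ P) {g : MvPowerSeries (Fin 2) k} (hg : toThree g ∈ P) :
    (X 1 - X 0 * h : MvPowerSeries (Fin 2) k) ∣ g := by
  -- shear by `h`, split off the `u₂`-free part, shear back
  set g' := shear h g with hg'
  set r := subst (![X 0, 0] : Fin 2 → MvPowerSeries (Fin 2) k) g' with hrdef
  have hr : ∀ e : Fin 2 →₀ ℕ, e 1 ≠ 0 → coeff e r = 0 := by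
    intro e he
    rw [hrdef, TOT2Curve.coeff_subst_killTwo, if_neg he]
  have hdvd' : (X 1 : MvPowerSeries (Fin 2) k) ∣ g' - r := by
    rw [TOT2Curve.X_one_dvd_iff_killTwo_eq_zero, ← coe_substAlgHom TOT2Curve.hasSubst_killTwo, map_sub, coe_substAlgHom,
      ← hrdef, TOT2Curve.killTwo_of_noY r hr, sub_self]
  obtain ⟨q', hq'⟩ := hdvd'
  -- shear back by `−h`
  have hnh : ∀ e : Fin 2 →₀ ℕ, e 1 ≠ 0 → coeff e (-h) = 0 := fun e he => by rw [map_neg, hh e he, neg_zero]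
  have hback : shear (-h) g' = g := by
    rw [hg', shear_shear_of_noY (-h) h g hh, neg_add_cancel, shear_zero_eq]
  have hg_eq : g = r + (X 1 - X 0 * h) * shear (-h) q' := by
    have h1 : g' = r + X 1 * q' := by rw [← hq']; ring
    have h2 := congrArg (shear (-h)) h1
    rw [hback, PureDescent.shear_add, shear_mul, TOT2Curve.shear_X_one, shear_eq_self_of_noY (-h) r hr] at h2
    rw [h2]; ring
  -- `r ∈ P`, hence `r = 0`
  have hr_mem : toThree r ∈ P := by
    have h3 : toThree g = toThree r + (X 1 - X 0 * toThree h) * toThree (shear (-h) q') := by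
      conv_lhs => rw [hg_eq]
      rw [map_add, map_mul, map_sub, map_mul, toThree_X, toThree_X]
      rfl
    have h4 : (X 1 - X 0 * toThree h) * toThree (shear (-h) q') ∈ P := Ideal.mul_mem_right _ _ hmem
    have := Ideal.sub_mem P hg h4
    rwa [h3, add_sub_cancel_right] at this
  have hr0 : r = 0 := eq_zero_of_noY_of_toThree_mem hX hr hr_mem
  rw [hg_eq, hr0, zero_add]
  exact Dvd.intro _ rfl

end TOT2Branch

end Summit.ResolutionOfSingularities.ResolutionOfSingularities.Theorems

end
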